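import Summits.ValiantsHypothesis.ValiantsHypothesis.Theorems.DivisionGapDefs

/-!
# Crux `DivisionGap.PerDivisionHard` (stmt-ValiantsHypothesis-5065), line `pair-descent-jss-endpoint` —
stub `stub_keyOfSpan`: a span of `q` integer matrices has a key of at most `q` cells

The FEW-GENERATORS rung of the line ("a cofactor that is a polynomial in few monomials never helps")
needs the following pure linear-algebra fact.  If all pairwise differences of a finite set `S` of
exponent vectors on the cells `[n] × [n]` lie in the `ℤ`-span of `q` integer matrices
`v 0, …, v (q-1)`, then some set `K` of at most `q` cells is a KEY for `S`: two elements of `S`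
agreeing on `K` are equal.

Proof (over `ℚ`).  For a cell `e` let `row e : Fin q → ℚ` be the column `s ↦ v s e`.  Choose a set
`b` of cells whose rows are linearly independent and span all rows
(`exists_linearIndepOn_extension`); it has at most `q = finrank ℚ (Fin q → ℚ)` elements
(`LinearIndependent.fintype_card_le_finrank`).  Given `m₁, m₂ ∈ S` agreeing on `b`, write
`m₁ - m₂ = Σ_s a_s • v s` and consider the functional `φ x = Σ_s a_s x_s`; then
`φ (row e) = m₁ e - m₂ e`, so `φ` vanishes on the rows of `b`, hence on their span, hence on every
row: `m₁ = m₂`.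
-/

noncomputable section

-- `Summit.ValiantsHypothesis.ValiantsHypothesis.…` is the tree's mandated single-conjunct layout
-- (Sub = Summit), so the duplicated namespace component is intended.
set_option linter.dupNamespace false

namespace Summit.ValiantsHypothesis.ValiantsHypothesis.Theorems.DivisionGapPerDivisionHard

/-- **`stub_keyOfSpan` (KEY OF A SPAN, line `pair-descent-jss-endpoint`).**  If all pairwise
differences of a finite set `S` of exponent vectors on `[n] × [n]` lie in the `ℤ`-span of `q`
integer matrices `v s`, then there is a set `K` of at most `q` cells such that two elements of `S`
agreeing on `K` are equal: take cells whose rows `s ↦ v s e` form a basis of the row space over `ℚ`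
(`exists_linearIndepOn_extension`, `LinearIndependent.fintype_card_le_finrank`); the functional
`x ↦ Σ_s a_s x_s` attached to a difference `m₁ - m₂ = Σ_s a_s • v s` evaluates to `m₁ e - m₂ e` on
the row of `e`, vanishes on the basis rows, hence everywhere. [folklore] -/
theorem stub_keyOfSpan :
    ∀ (n q : ℕ) (v : Fin q → (Fin n × Fin n) → ℤ) (S : Finset ((Fin n × Fin n) →₀ ℕ)),
      (∀ m₁ ∈ S, ∀ m₂ ∈ S, ∃ a : Fin q → ℤ, ∀ e, (m₁ e : ℤ) - m₂ e = ∑ s, a s * v s e) →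
      ∃ K : Finset (Fin n × Fin n), K.card ≤ q ∧
        ∀ m₁ ∈ S, ∀ m₂ ∈ S, (∀ e ∈ K, m₁ e = m₂ e) → m₁ = m₂ := by
  intro n q v S hS
  classical
  -- the rows over `ℚ`: `row e s = v s e`
  obtain ⟨row, hrow⟩ : ∃ row : (Fin n × Fin n) → (Fin q → ℚ), ∀ e s, row e s = (v s e : ℚ) :=
    ⟨fun e s => (v s e : ℚ), fun _ _ => rfl⟩
  -- a linearly independent set of rows spanning all rows
  obtain ⟨b, -, -, hspan, hli⟩ :=
    exists_linearIndepOn_extension (linearIndepOn_empty ℚ row) (Set.empty_subset Set.univ)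
  refine ⟨b.toFinset, ?_, ?_⟩
  · -- at most `q` independent vectors in `Fin q → ℚ`
    have hcard := hli.linearIndependent.fintype_card_le_finrank
    rw [Module.finrank_fin_fun] at hcard
    simpa only [Set.toFinset_card] using hcard
  · intro m₁ hm₁ m₂ hm₂ hK
    obtain ⟨a, ha⟩ := hS m₁ hm₁ m₂ hm₂
    -- the functional `x ↦ Σ_s a_s x_s`
    let φ : (Fin q → ℚ) →ₗ[ℚ] ℚ := ∑ s, (a s : ℚ) • LinearMap.proj s
    have hφ : ∀ e, φ (row e) = (m₁ e : ℚ) - m₂ e := fun e => by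
      have h := congrArg (Int.cast : ℤ → ℚ) (ha e)
      push_cast at h
      simp only [φ, LinearMap.coe_sum, Finset.sum_apply, LinearMap.smul_apply,
        LinearMap.proj_apply, hrow, smul_eq_mul, h]
    -- `φ` vanishes on the rows of `b`, hence on their span
    have hle : Submodule.span ℚ (row '' b) ≤ LinearMap.ker φ := by
      rw [Submodule.span_le]
      rintro _ ⟨e, he, rfl⟩
      rw [SetLike.mem_coe, LinearMap.mem_ker, hφ, hK e (Set.mem_toFinset.mpr he), sub_self]
    -- hence on every row
    refine Finsupp.ext fun e => ?_
    have hmem : row e ∈ Submodule.span ℚ (row '' b) := hspan ⟨e, Set.mem_univ _, rfl⟩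
    have h0 : φ (row e) = 0 := LinearMap.mem_ker.mp (hle hmem)
    rw [hφ, sub_eq_zero] at h0
    exact_mod_cast h0

end Summit.ValiantsHypothesis.ValiantsHypothesis.Theorems.DivisionGapPerDivisionHard
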